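import Summits.Ventures.PercRepro.PuncturedLYMCoHypMain

/-!
# PercRepro — TWO DISJOINT CO-HYPERPLANES: THE REDUCTION OF (SP) TO THREE SEQUENCES IN TWO INDICES (p10, gen 34)

For two disjoint sets `C₁, C₂` with `#C₁ + #C₂ ≥ j + 2` (two nontrivial hyperplanes `E ∖ C₁`, `E ∖ C₂` of a paving
matroid meeting in at most `r − 2` points, the case `C₁ ∩ C₂ = ∅`), the family `D = upLevel j C₁ ∪ upLevel j C₂` of
`j`-sets containing `C₁` or `C₂` is the co-code; no `(j+1)`-set contains both.  The SYMMETRIC weights are three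
sequences in the profile `(a, b) = (#(X ∩ C₁), #(X ∩ C₂))`: the completion `X ↦ insert y X` has weight `wA a b` for
`y ∈ C₁`, `wB a b` for `y ∈ C₂`, `wR a b` otherwise (`hW2`, `hW2p`).
* `sum_sups_hW2` — the row sum at `X`: `(m₁ − a)·wA + (m₂ − b)·wB + (n − j − m₁ − m₂ + a + b)·wR`;
* `sum_subsP_hW2_untouched` — the column sum at a `(j+1)`-set containing neither: `a'·wA (a'−1) b' + b'·wB a' (b'−1) +
  (j + 1 − a' − b')·wR a' b'`; `sum_subsP_hW2_top₁` / `top₂` — at a set containing `C₁` (resp. `C₂`): `m₁·wA (m₁−1) b'`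
  (resp. `m₂·wB a' (m₂−1)`);
* the reduction to three sequences (`puncturedNMP_two_of_seq`) is in PuncturedLYMTwoCoHypMain.
The sequences themselves (the superposition of the two one-co-hyperplane flows corrected on the boundary layers, see
proofs/P10-BOUNDARY-g34.md §2′) are NOT constructed here; nothing asserts (SP), (PAV) or (NC).
-/

namespace PercRepro.PuncturedLYM

open Finset

variable {α : Type} [Fintype α] [DecidableEq α]

/-- Membership in `P` for the union of two up-levels: the `j`-sets containing neither `C₁` nor `C₂`. -/
theorem mem_punctured_union_upLevel {j : ℕ} {C₁ C₂ X : Finset α} :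
    X ∈ punctured j (upLevel j C₁ ∪ upLevel j C₂) ↔ X.card = j ∧ ¬ C₁ ⊆ X ∧ ¬ C₂ ⊆ X := by
  rw [mem_punctured, mem_union, mem_upLevel, mem_upLevel]
  constructor
  · rintro ⟨hX, h⟩
    exact ⟨hX, fun h1 => h (Or.inl ⟨hX, h1⟩), fun h2 => h (Or.inr ⟨hX, h2⟩)⟩
  · rintro ⟨hX, h1, h2⟩
    refine ⟨hX, ?_⟩
    rintro (⟨-, hC⟩ | ⟨-, hC⟩)
    · exact h1 hC
    · exact h2 hC

/-! ### The weights -/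

/-- The weight of the completion `X ↦ insert y X`: `wA a b` for `y ∈ C₁`, `wB a b` for `y ∈ C₂`, `wR a b` otherwise,
with `a = #(X ∩ C₁)`, `b = #(X ∩ C₂)`. -/
def hW2 (wA wB wR : ℕ → ℕ → ℚ) (C₁ C₂ X : Finset α) (y : α) : ℚ :=
  if y ∈ C₁ then wA (aOf C₁ X) (aOf C₂ X)
  else if y ∈ C₂ then wB (aOf C₁ X) (aOf C₂ X)
  else wR (aOf C₁ X) (aOf C₂ X)

/-- The weights on a pair `(X, Y)`: `hW2` at the point of `Y ∖ X`. -/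
def hW2p (wA wB wR : ℕ → ℕ → ℚ) (C₁ C₂ X Y : Finset α) : ℚ :=
  ∑ y ∈ Y \ X, hW2 wA wB wR C₁ C₂ X y

omit [Fintype α] in
/-- `hW2p X (insert y X) = hW2 X y` for `y ∉ X`. -/
theorem hW2p_insert (wA wB wR : ℕ → ℕ → ℚ) (C₁ C₂ X : Finset α) {y : α} (hy : y ∉ X) :
    hW2p wA wB wR C₁ C₂ X (insert y X) = hW2 wA wB wR C₁ C₂ X y := by
  unfold hW2p
  have h : insert y X \ X = {y} := by
    ext z
    simp only [mem_sdiff, mem_insert, mem_singleton]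
    constructor
    · rintro ⟨h1, h2⟩
      exact h1.resolve_right h2
    · rintro rfl
      exact ⟨Or.inl rfl, hy⟩
  rw [h, sum_singleton]

/-! ### Row sums -/

/-- **The row sum at a `j`-set `X`** (`C₁, C₂` disjoint):
`(m₁ − a)·wA a b + (m₂ − b)·wB a b + (n − j − m₁ − m₂ + a + b)·wR a b`. -/
theorem sum_sups_hW2 {j : ℕ} (wA wB wR : ℕ → ℕ → ℚ) {C₁ C₂ X : Finset α} (hdisj : Disjoint C₁ C₂)
    (hX : X.card = j) :
    ∑ Y ∈ sups j X, hW2p wA wB wR C₁ C₂ X Y =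
      ((C₁.card : ℚ) - aOf C₁ X) * wA (aOf C₁ X) (aOf C₂ X) +
        ((C₂.card : ℚ) - aOf C₂ X) * wB (aOf C₁ X) (aOf C₂ X) +
        ((Fintype.card α : ℚ) - j - C₁.card - C₂.card + aOf C₁ X + aOf C₂ X) * wR (aOf C₁ X) (aOf C₂ X) := by
  rw [sum_sups hX]
  have h1 : ∀ y ∈ univ \ X, hW2p wA wB wR C₁ C₂ X (insert y X) = hW2 wA wB wR C₁ C₂ X y :=
    fun y hy => hW2p_insert wA wB wR C₁ C₂ X (mem_sdiff.1 hy).2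
  rw [sum_congr rfl h1]
  unfold hW2
  rw [sum_ite, sum_ite, sum_const, sum_const, sum_const, nsmul_eq_mul, nsmul_eq_mul, nsmul_eq_mul]
  have hA : (univ \ X).filter (fun y => y ∈ C₁) = C₁ \ X := by
    ext y
    simp only [mem_filter, mem_sdiff, mem_univ, true_and]
    tauto
  have hB : ((univ \ X).filter (fun y => ¬ y ∈ C₁)).filter (fun y => y ∈ C₂) = C₂ \ X := by
    ext y
    simp only [mem_filter, mem_sdiff, mem_univ, true_and]
    constructor
    · rintro ⟨⟨hyX, -⟩, hyC⟩
      exact ⟨hyC, hyX⟩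
    · rintro ⟨hyC, hyX⟩
      exact ⟨⟨hyX, fun h => disjoint_left.1 hdisj h hyC⟩, hyC⟩
  have hR : ((univ \ X).filter (fun y => ¬ y ∈ C₁)).filter (fun y => ¬ y ∈ C₂) = univ \ (X ∪ C₁ ∪ C₂) := by
    ext y
    simp only [mem_filter, mem_sdiff, mem_univ, true_and, mem_union, not_or]
  rw [hA, hB, hR, card_univ_sdiff]
  have hc1 := card_sdiff_B (X := X) (B := C₁) rfl
  have hc2 := card_sdiff_B (X := X) (B := C₂) rfl
  have ha : aOf C₁ X ≤ C₁.card := by omega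
  have hb : aOf C₂ X ≤ C₂.card := by omega
  have hu : (X ∪ C₁ ∪ C₂).card = j + (C₁.card - aOf C₁ X) + (C₂.card - aOf C₂ X) := by
    have e : X ∪ C₁ ∪ C₂ = X ∪ ((C₁ \ X) ∪ (C₂ \ X)) := by
      ext y
      simp only [mem_union, mem_sdiff]
      tauto
    have d1 : Disjoint (C₁ \ X) (C₂ \ X) := hdisj.mono sdiff_subset sdiff_subset
    have d2 : Disjoint X ((C₁ \ X) ∪ (C₂ \ X)) := disjoint_union_right.2 ⟨disjoint_sdiff, disjoint_sdiff⟩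
    rw [e, card_union_of_disjoint d2, card_union_of_disjoint d1, hX]
    omega
  have hXC : (X ∪ C₁ ∪ C₂).card ≤ Fintype.card α := card_le_univ _
  have e1 : ((C₁ \ X).card : ℚ) = C₁.card - aOf C₁ X := by
    have : (C₁ \ X).card = C₁.card - aOf C₁ X := by omega
    rw [this, Nat.cast_sub ha]
  have e2 : ((C₂ \ X).card : ℚ) = C₂.card - aOf C₂ X := by
    have : (C₂ \ X).card = C₂.card - aOf C₂ X := by omega
    rw [this, Nat.cast_sub hb]
  have e3 : ((Fintype.card α - (X ∪ C₁ ∪ C₂).card : ℕ) : ℚ) =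
      (Fintype.card α : ℚ) - j - C₁.card - C₂.card + aOf C₁ X + aOf C₂ X := by
    rw [Nat.cast_sub hXC, hu, Nat.cast_add, Nat.cast_add, Nat.cast_sub ha, Nat.cast_sub hb]
    ring
  rw [e1, e2, e3]
  ring

/-! ### Column sums -/

/-- The `P`-subsets of a `(j+1)`-set `Y` containing neither `C₁` nor `C₂` are all its `j`-subsets `Y.erase z`. -/
theorem subsP_union_upLevel_eq_image_erase {j : ℕ} {C₁ C₂ Y : Finset α} (hY : Y.card = j + 1)
    (h1 : ¬ C₁ ⊆ Y) (h2 : ¬ C₂ ⊆ Y) :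
    subsP j (upLevel j C₁ ∪ upLevel j C₂) Y = Y.image (fun z => Y.erase z) := by
  ext X
  simp only [mem_subsP, mem_image, mem_union, mem_upLevel]
  constructor
  · rintro ⟨⟨hXc, -⟩, hXY⟩
    have hc : (Y \ X).card = 1 := by
      rw [card_sdiff_of_subset hXY]
      omega
    obtain ⟨z, hz⟩ := card_eq_one.1 hc
    have hzY : z ∈ Y \ X := hz ▸ mem_singleton_self z
    rw [mem_sdiff] at hzY
    refine ⟨z, hzY.1, ?_⟩
    symm
    apply eq_of_subset_of_card_le
    · intro w hw
      rw [mem_erase]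
      refine ⟨?_, hXY hw⟩
      rintro rfl
      exact hzY.2 hw
    · rw [card_erase_of_mem hzY.1, hY, hXc, Nat.add_sub_cancel]
  · rintro ⟨z, hzY, rfl⟩
    refine ⟨⟨by rw [card_erase_of_mem hzY, hY, Nat.add_sub_cancel], ?_⟩, erase_subset z Y⟩
    rintro (⟨-, hC⟩ | ⟨-, hC⟩)
    · exact h1 (hC.trans (erase_subset z Y))
    · exact h2 (hC.trans (erase_subset z Y))

/-- The `P`-subsets of a `(j+1)`-set `Y ⊇ C₁` not containing `C₂` are the `Y.erase z`, `z ∈ C₁`. -/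
theorem subsP_union_upLevel_eq_image_erase_top {j : ℕ} {C₁ C₂ Y : Finset α} (hY : Y.card = j + 1)
    (h1 : C₁ ⊆ Y) (h2 : ¬ C₂ ⊆ Y) :
    subsP j (upLevel j C₁ ∪ upLevel j C₂) Y = C₁.image (fun z => Y.erase z) := by
  ext X
  simp only [mem_subsP, mem_image, mem_union, mem_upLevel]
  constructor
  · rintro ⟨⟨hXc, hXD⟩, hXY⟩
    have hc : (Y \ X).card = 1 := by
      rw [card_sdiff_of_subset hXY]
      omega
    obtain ⟨z, hz⟩ := card_eq_one.1 hc
    have hzY : z ∈ Y \ X := hz ▸ mem_singleton_self z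
    rw [mem_sdiff] at hzY
    have hXe : X = Y.erase z := by
      apply eq_of_subset_of_card_le
      · intro w hw
        rw [mem_erase]
        refine ⟨?_, hXY hw⟩
        rintro rfl
        exact hzY.2 hw
      · rw [card_erase_of_mem hzY.1, hY, hXc, Nat.add_sub_cancel]
    refine ⟨z, ?_, hXe.symm⟩
    by_contra hzC
    apply hXD
    refine Or.inl ⟨hXc, ?_⟩
    rw [hXe]
    intro w hw
    rw [mem_erase]
    exact ⟨fun h => hzC (h ▸ hw), h1 hw⟩
  · rintro ⟨z, hzC, rfl⟩
    refine ⟨⟨by rw [card_erase_of_mem (h1 hzC), hY, Nat.add_sub_cancel], ?_⟩, erase_subset z Y⟩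
    rintro (⟨-, hC⟩ | ⟨-, hC⟩)
    · have := hC hzC
      rw [mem_erase] at this
      exact this.1 rfl
    · exact h2 (hC.trans (erase_subset z Y))

/-- **The column sum at a `(j+1)`-set `Y` containing neither `C₁` nor `C₂`** (`C₁, C₂` disjoint), with
`a' = #(Y ∩ C₁)`, `b' = #(Y ∩ C₂)`: `a'·wA (a' − 1) b' + b'·wB a' (b' − 1) + (j + 1 − a' − b')·wR a' b'`. -/
theorem sum_subsP_hW2_untouched {j : ℕ} (wA wB wR : ℕ → ℕ → ℚ) {C₁ C₂ Y : Finset α} (hdisj : Disjoint C₁ C₂)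
    (hY : Y.card = j + 1) (h1 : ¬ C₁ ⊆ Y) (h2 : ¬ C₂ ⊆ Y) :
    ∑ X ∈ subsP j (upLevel j C₁ ∪ upLevel j C₂) Y, hW2p wA wB wR C₁ C₂ X Y =
      ((Y ∩ C₁).card : ℚ) * wA ((Y ∩ C₁).card - 1) (Y ∩ C₂).card +
        ((Y ∩ C₂).card : ℚ) * wB (Y ∩ C₁).card ((Y ∩ C₂).card - 1) +
        ((j : ℚ) + 1 - (Y ∩ C₁).card - (Y ∩ C₂).card) * wR (Y ∩ C₁).card (Y ∩ C₂).card := by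
  rw [subsP_union_upLevel_eq_image_erase hY h1 h2, sum_image (erase_injOn Y)]
  have hterm : ∀ z ∈ Y, hW2p wA wB wR C₁ C₂ (Y.erase z) Y =
      if z ∈ C₁ then wA ((Y ∩ C₁).card - 1) (Y ∩ C₂).card
      else if z ∈ C₂ then wB (Y ∩ C₁).card ((Y ∩ C₂).card - 1)
      else wR (Y ∩ C₁).card (Y ∩ C₂).card := by
    intro z hz
    unfold hW2p
    rw [sdiff_erase_eq_singleton hz, sum_singleton]
    unfold hW2
    have hk1 := aOf_erase C₁ hz
    have hk2 := aOf_erase C₂ hz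
    split_ifs with hz1 hz2
    · have hz2 : z ∉ C₂ := fun h => disjoint_left.1 hdisj hz1 h
      rw [if_pos hz1] at hk1
      rw [if_neg hz2, add_zero] at hk2
      have : aOf C₁ (Y.erase z) = (Y ∩ C₁).card - 1 := by omega
      rw [this, hk2]
    · rw [if_neg hz1, add_zero] at hk1
      rw [if_pos hz2] at hk2
      have : aOf C₂ (Y.erase z) = (Y ∩ C₂).card - 1 := by omega
      rw [this, hk1]
    · rw [if_neg hz1, add_zero] at hk1
      rw [if_neg hz2, add_zero] at hk2
      rw [hk1, hk2]
  rw [sum_congr rfl hterm, sum_ite, sum_ite, sum_const, sum_const, sum_const, nsmul_eq_mul, nsmul_eq_mul,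
    nsmul_eq_mul]
  have hk1 : (Y.filter (fun z => z ∈ C₁)).card = (Y ∩ C₁).card := by rw [filter_mem_eq_inter]
  have hk2 : ((Y.filter (fun z => ¬ z ∈ C₁)).filter (fun z => z ∈ C₂)).card = (Y ∩ C₂).card := by
    have e : (Y.filter (fun z => ¬ z ∈ C₁)).filter (fun z => z ∈ C₂) = Y ∩ C₂ := by
      ext z
      simp only [mem_filter, mem_inter]
      constructor
      · rintro ⟨⟨hzY, -⟩, hzC⟩
        exact ⟨hzY, hzC⟩
      · rintro ⟨hzY, hzC⟩
        exact ⟨⟨hzY, fun h => disjoint_left.1 hdisj h hzC⟩, hzC⟩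
    rw [e]
  have hk3 : ((Y.filter (fun z => ¬ z ∈ C₁)).filter (fun z => ¬ z ∈ C₂)).card = j + 1 - (Y ∩ C₁).card - (Y ∩ C₂).card := by
    have h1' := card_filter_add_card_filter_not (fun z => z ∈ C₁) (s := Y)
    have h2' := card_filter_add_card_filter_not (fun z => z ∈ C₂) (s := Y.filter (fun z => ¬ z ∈ C₁))
    rw [hY] at h1'
    rw [hk1] at h1'
    rw [hk2] at h2'
    omega
  have hY1 : (Y ∩ C₁).card ≤ j + 1 := hY ▸ card_le_card inter_subset_left
  have hY12 : (Y ∩ C₁).card + (Y ∩ C₂).card ≤ j + 1 := by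
    have e : (Y ∩ C₁) ∪ (Y ∩ C₂) = Y ∩ (C₁ ∪ C₂) := (inter_union_distrib_left Y C₁ C₂).symm
    have d : Disjoint (Y ∩ C₁) (Y ∩ C₂) := hdisj.mono inter_subset_right inter_subset_right
    have := card_union_of_disjoint d
    rw [e] at this
    have := card_le_card (inter_subset_left (s₁ := Y) (s₂ := C₁ ∪ C₂))
    omega
  rw [hk1, hk2, hk3, Nat.cast_sub (by omega), Nat.cast_sub hY1]
  push_cast
  ring

/-- **The column sum at a `(j+1)`-set `Y ⊇ C₁` not containing `C₂`** (`C₁, C₂` disjoint): `m₁·wA (m₁ − 1) b'`,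
`b' = #(Y ∩ C₂)`. -/
theorem sum_subsP_hW2_top₁ {j : ℕ} (wA wB wR : ℕ → ℕ → ℚ) {C₁ C₂ Y : Finset α} (hdisj : Disjoint C₁ C₂)
    (hY : Y.card = j + 1) (h1 : C₁ ⊆ Y) (h2 : ¬ C₂ ⊆ Y) :
    ∑ X ∈ subsP j (upLevel j C₁ ∪ upLevel j C₂) Y, hW2p wA wB wR C₁ C₂ X Y =
      (C₁.card : ℚ) * wA (C₁.card - 1) (Y ∩ C₂).card := by
  rw [subsP_union_upLevel_eq_image_erase_top hY h1 h2, sum_image ((erase_injOn Y).mono (coe_subset.2 h1))]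
  have hterm : ∀ z ∈ C₁, hW2p wA wB wR C₁ C₂ (Y.erase z) Y = wA (C₁.card - 1) (Y ∩ C₂).card := by
    intro z hz
    unfold hW2p
    rw [sdiff_erase_eq_singleton (h1 hz), sum_singleton]
    unfold hW2
    rw [if_pos hz]
    have hk1 := aOf_erase C₁ (h1 hz)
    have hk2 := aOf_erase C₂ (h1 hz)
    rw [if_pos hz] at hk1
    rw [if_neg (fun h => disjoint_left.1 hdisj hz h), add_zero] at hk2
    have hYC : Y ∩ C₁ = C₁ := inter_eq_right.2 h1
    rw [hYC] at hk1
    have : aOf C₁ (Y.erase z) = C₁.card - 1 := by omega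
    rw [this, hk2]
  rw [sum_congr rfl hterm, sum_const, nsmul_eq_mul]

/-- **The column sum at a `(j+1)`-set `Y ⊇ C₂` not containing `C₁`** (`C₁, C₂` disjoint): `m₂·wB a' (m₂ − 1)`,
`a' = #(Y ∩ C₁)`. -/
theorem sum_subsP_hW2_top₂ {j : ℕ} (wA wB wR : ℕ → ℕ → ℚ) {C₁ C₂ Y : Finset α} (hdisj : Disjoint C₁ C₂)
    (hY : Y.card = j + 1) (h1 : ¬ C₁ ⊆ Y) (h2 : C₂ ⊆ Y) :
    ∑ X ∈ subsP j (upLevel j C₁ ∪ upLevel j C₂) Y, hW2p wA wB wR C₁ C₂ X Y =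
      (C₂.card : ℚ) * wB (Y ∩ C₁).card (C₂.card - 1) := by
  have hsub : subsP j (upLevel j C₁ ∪ upLevel j C₂) Y = C₂.image (fun z => Y.erase z) := by
    rw [union_comm]
    exact subsP_union_upLevel_eq_image_erase_top hY h2 h1
  rw [hsub, sum_image ((erase_injOn Y).mono (coe_subset.2 h2))]
  have hterm : ∀ z ∈ C₂, hW2p wA wB wR C₁ C₂ (Y.erase z) Y = wB (Y ∩ C₁).card (C₂.card - 1) := by
    intro z hz
    unfold hW2p
    rw [sdiff_erase_eq_singleton (h2 hz), sum_singleton]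
    unfold hW2
    have hz1 : z ∉ C₁ := fun h => disjoint_left.1 hdisj h hz
    rw [if_neg hz1, if_pos hz]
    have hk1 := aOf_erase C₁ (h2 hz)
    have hk2 := aOf_erase C₂ (h2 hz)
    rw [if_neg hz1, add_zero] at hk1
    rw [if_pos hz] at hk2
    have hYC : Y ∩ C₂ = C₂ := inter_eq_right.2 h2
    rw [hYC] at hk2
    have : aOf C₂ (Y.erase z) = C₂.card - 1 := by omega
    rw [this, hk1]
  rw [sum_congr rfl hterm, sum_const, nsmul_eq_mul]

end PercRepro.PuncturedLYM
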